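import Literature.Computability.MetaComplexity.PromiseRandReductions
import Literature.Computability.Complexity.BPPErrorReduction
import Literature.Computability.Complexity.PostBPPCoinRuns
import HarnessLib

/-!
# Randomized promise reductions from a polynomial-time map on `⟨input, coins⟩` and a counting bound

Topic `Computability/MetaComplexity`, namespace `Literature.Computability.MetaComplexity` (the
constructor `RandAlg.ofPairFn` is a dot-extension in `Literature.Computability.Complexity.RandAlg`,
as the precedent `RandAlg.precomp` of `PromiseRandReductions.lean`). The notion
`PromiseRandReducible Q₁ Q₂` (`PromiseRandReductions.lean`: a PPT algorithm `A(x; r)` reading exactly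
`q(|x|)` coins, correct with probability `≥ 2/3` on each side of the promise) asks for a `RandAlg`;
a reduction described in print — e.g. Khot's `SAT → GapSVP` (J. ACM 52 (2005), Thm. 1.1; the target
of `Literature.Algebra.EuclideanLattices.Khot2005_SAT_randReducible_gapSVP`) — is a deterministic
polynomial-time map `F` of the pair `⟨x, r⟩` together with a COUNT of the good coin strings
`r ∈ {0,1}^{q(|x|)}`. This file packages the passage once (all PROVED, library-first):

* `RandAlg.ofPairFn F q` (`run x r := F ⟨x, r⟩`, `coinLen := q`), `RandAlg.isPolyTime_ofPairFn`
  (`F ∈ FP` ⇒ PPT, by same-machine transport `PolyTimeComputable.of_encode_eq`),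
  `RandAlg.pr_ofPairFn` (`Pr = uniformProb (q |x|) {r | F ⟨x, r⟩ ∈ E}`), `RandAlg.pr_ofPairFn_eq_cnt_div`;
* `promiseRandReducible_of_uniformProb`, `promiseRandReducible_of_cnt` — **the constructor**: `F ∈ FP`
  plus `Pr_r[F ⟨x, r⟩ ∈ Q₂.yes] ≥ 2/3` for `x ∈ Q₁.yes` and `Pr_r[F ⟨x, r⟩ ∈ Q₂.no] ≥ 2/3` for
  `x ∈ Q₁.no` (as real probabilities, or as the integer inequalities `2·2^{q|x|} ≤ 3·cnt`) give
  `PromiseRandReducible Q₁ Q₂`;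
* `uniformProb_eq_of_marginal`, `le_uniformProb_of_marginal` — **structured randomness**: if the
  event is decided by finitely many DISTINCT coin positions `ι : J ↪ Fin m` relabelled by a
  bijection `θ : (J → Bool) ≃ Ω` onto a finite sample space (tuples of indices, vectors of numbers
  below a power of two, …), then `Pr_r[E] = #{o | P o} / |Ω|`, and a bound "at most an `a/b` fraction
  of `Ω` is bad" gives `Pr_r[E] ≥ 1 - a/b`. These are thin wrappers of the landed counting identity
  `PostBPPHash.card_filter_comp_equiv_mul` (`Complexity/PostBPPCoinRuns.lean`); the abstract
  equal-fibre principle exists as `MetaComplexity.card_filter_comp_mul_card` (`GGM.lean`) and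
  `Cryptography.card_filter_fst_equiv` (`BlumMicaliSampling.lean`) and is not re-proved here. For
  residues modulo a non-power-of-two see `Complexity/ResidueSampling.lean`.

## References

* S. Arora, B. Barak, *Computational Complexity: A Modern Approach*, CUP 2009, Def. 7.3 (the
  normal form `M(x, r)`, `r ∈ {0,1}^{p(|x|)}`), Def. 7.16 and §7.6 (randomized reductions), §7.1
  (probabilities as fractions of coin strings), §A.2.
* O. Goldreich, *On promise problems: a survey*, LNCS 3895 (2006), Def. 1.4.
-/

noncomputable section

namespace Literature.Computability.Complexity.RandAlg

open _root_.Computability Polynomial Finset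

/-! ### The randomized algorithm of a string function on pair codes -/

/-- **`RandAlg.ofPairFn F q`**: the randomized algorithm `A(x; r) := F ⟨x, r⟩` reading exactly
`q(|x|)` coins — Arora–Barak's normal form `M(x, r)` of a probabilistic polynomial-time machine,
with the deterministic machine given as a string function `F` on the pair code `boolPair x r`.
[cite: AroraBarak2009, Def. 7.3] -/
def ofPairFn (F : List Bool → List Bool) (q : Polynomial ℕ) : RandAlg (List Bool) (List Bool) where
  run x r := F (boolPair x r)
  coinLen n := q.eval n

/-- The run map of `ofPairFn F q` (definitional). [folklore] -/
@[simp] theorem ofPairFn_run (F : List Bool → List Bool) (q : Polynomial ℕ) (x r : List Bool) :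
    (ofPairFn F q).run x r = F (boolPair x r) :=
  rfl

/-- The coin budget of `ofPairFn F q` (definitional). [folklore] -/
@[simp] theorem ofPairFn_coinLen (F : List Bool → List Bool) (q : Polynomial ℕ) (n : ℕ) :
    (ofPairFn F q).coinLen n = q.eval n :=
  rfl

/-- **`F ∈ FP` makes `ofPairFn F q` a PPT algorithm**: the pair presentation
`p ↦ boolPair p.1 p.2` of `RandAlg.IsPolyTime` is served by the very machine of `F`
(`PolyTimeComputable.of_encode_eq` along `uncurry boolPair`), and the budget `q` is a polynomial.
[cite: AroraBarak2009, Def. 7.3] -/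
theorem isPolyTime_ofPairFn {F : List Bool → List Bool} (hF : F ∈ FP) (q : Polynomial ℕ) :
    (ofPairFn F q).IsPolyTime id (id : List Bool → List Bool) :=
  ⟨PolyTimeComputable.of_encode_eq (f := F) (ea := id) (eb := id)
      (f' := Function.uncurry (ofPairFn F q).run) (Function.uncurry boolPair)
      (fun _ => rfl) (fun _ => rfl) hF,
    q, fun _ => le_rfl⟩

/-- **Probabilities of `ofPairFn F q` are fractions of coin strings**:
`Pr[A(x) ∈ E] = uniformProb (q |x|) {r | F ⟨x, r⟩ ∈ E}`. [cite: AroraBarak2009, §7.1] -/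
theorem pr_ofPairFn (F : List Bool → List Bool) (q : Polynomial ℕ) (x : List Bool) (E : Set (List Bool)) :
    (ofPairFn F q).pr id x E = uniformProb (q.eval x.length) {r | F (boolPair x r) ∈ E} :=
  pr_eq_uniformProb _ _ _ _

/-- The same with the integer numerator `cnt`: `Pr[A(x) ∈ E] = cnt (q |x|) {r | F ⟨x, r⟩ ∈ E} / 2^{q |x|}`.
[cite: AroraBarak2009, §7.1] -/
theorem pr_ofPairFn_eq_cnt_div (F : List Bool → List Bool) (q : Polynomial ℕ) (x : List Bool)
    (E : Set (List Bool)) :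
    (ofPairFn F q).pr id x E = (cnt (q.eval x.length) {r | F (boolPair x r) ∈ E} : ℝ) / 2 ^ q.eval x.length := by
  rw [pr_ofPairFn, uniformProb_eq_cnt_div]

/-- Integer criterion for a probability bound `a/b ≤ Pr[A(x) ∈ E]`: `a · 2^{q|x|} ≤ b · cnt`.
[cite: AroraBarak2009, §7.1] -/
theorem div_le_pr_ofPairFn_of_cnt {F : List Bool → List Bool} {q : Polynomial ℕ} {x : List Bool}
    {E : Set (List Bool)} {a b : ℕ} (hb : 0 < b)
    (h : a * 2 ^ q.eval x.length ≤ b * cnt (q.eval x.length) {r | F (boolPair x r) ∈ E}) :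
    (a / b : ℝ) ≤ (ofPairFn F q).pr id x E := by
  rw [pr_ofPairFn_eq_cnt_div, div_le_div_iff₀ (by exact_mod_cast hb) (by positivity),
    mul_comm ((cnt _ _ : ℕ) : ℝ)]
  exact_mod_cast h

end Literature.Computability.Complexity.RandAlg

namespace Literature.Computability.MetaComplexity

open _root_.Computability Polynomial Finset Complexity Complexity.PromiseProblem Complexity.RandAlg

/-! ### The constructor of randomized promise reductions -/

/-- **A polynomial-time map on `⟨x, r⟩` with the right success probabilities is a randomized
promise reduction.** If `F ∈ FP` and, counting coin strings `r ∈ {0,1}^{q(|x|)}`,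
`Pr_r[F ⟨x, r⟩ ∈ Q₂.yes] ≥ 2/3` for every `x ∈ Q₁.yes` and `Pr_r[F ⟨x, r⟩ ∈ Q₂.no] ≥ 2/3` for
every `x ∈ Q₁.no`, then `PromiseRandReducible Q₁ Q₂` (witness `RandAlg.ofPairFn F q`).
[cite: AroraBarak2009, Def. 7.16 and Def. 7.3] -/
theorem promiseRandReducible_of_uniformProb {Q₁ Q₂ : PromiseProblem} {F : List Bool → List Bool}
    (hF : F ∈ FP) (q : Polynomial ℕ)
    (hy : ∀ x ∈ Q₁.yes, (2 / 3 : ℝ) ≤ uniformProb (q.eval x.length) {r | F (boolPair x r) ∈ Q₂.yes})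
    (hn : ∀ x ∈ Q₁.no, (2 / 3 : ℝ) ≤ uniformProb (q.eval x.length) {r | F (boolPair x r) ∈ Q₂.no}) :
    PromiseRandReducible Q₁ Q₂ :=
  ⟨ofPairFn F q, isPolyTime_ofPairFn hF q, ⟨q, fun _ => rfl⟩,
    fun x hx => by rw [pr_ofPairFn]; exact hy x hx,
    fun x hx => by rw [pr_ofPairFn]; exact hn x hx⟩

/-- **Integer form of the constructor**: `2 · 2^{q|x|} ≤ 3 · #{good r}` on each side of the
promise. [cite: AroraBarak2009, Def. 7.16 and Def. 7.3] -/
theorem promiseRandReducible_of_cnt {Q₁ Q₂ : PromiseProblem} {F : List Bool → List Bool}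
    (hF : F ∈ FP) (q : Polynomial ℕ)
    (hy : ∀ x ∈ Q₁.yes, 2 * 2 ^ q.eval x.length ≤ 3 * cnt (q.eval x.length) {r | F (boolPair x r) ∈ Q₂.yes})
    (hn : ∀ x ∈ Q₁.no, 2 * 2 ^ q.eval x.length ≤ 3 * cnt (q.eval x.length) {r | F (boolPair x r) ∈ Q₂.no}) :
    PromiseRandReducible Q₁ Q₂ :=
  ⟨ofPairFn F q, isPolyTime_ofPairFn hF q, ⟨q, fun _ => rfl⟩,
    fun x hx => by
      have h := div_le_pr_ofPairFn_of_cnt (F := F) (q := q) (x := x) (by norm_num : (0 : ℕ) < 3) (hy x hx)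
      norm_num at h
      exact h,
    fun x hx => by
      have h := div_le_pr_ofPairFn_of_cnt (F := F) (q := q) (x := x) (by norm_num : (0 : ℕ) < 3) (hn x hx)
      norm_num at h
      exact h⟩

/-! ### Structured randomness: events decided by distinct coin positions -/

section Marginal

variable {J : Type} [Fintype J] {Ω : Type} [Fintype Ω] {m : ℕ}

/-- **`uniformProb` of an event decided by a uniform structured sample.** If distinct coin positions
`ι : J → Fin m` (injective) relabelled by `θ : (J → Bool) ≃ Ω` decide the event — `ofFn f ∈ E ↔
P (θ (f ∘ ι))` for every `f : Fin m → Bool` — then `Pr_{r ∈ {0,1}^m}[r ∈ E] = #{o | P o} / |Ω|`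
(`uniformProb_eq_card_fun` and the counting identity `PostBPPHash.card_filter_comp_equiv_mul`).
[folklore] -/
theorem uniformProb_eq_of_marginal (ι : J → Fin m) (hι : Function.Injective ι) (θ : (J → Bool) ≃ Ω)
    (P : Ω → Prop) [DecidablePred P] (E : Set (List Bool))
    (hE : ∀ f : Fin m → Bool, List.ofFn f ∈ E ↔ P (θ (f ∘ ι))) :
    uniformProb m E = (#{o | P o} : ℝ) / Fintype.card Ω := by
  classical
  have hΩ : (0 : ℝ) < Fintype.card Ω := by
    exact_mod_cast Fintype.card_pos_iff.2 ⟨θ fun _ => true⟩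
  rw [uniformProb_eq_card_fun]
  have key : ∀ A : Finset (Fin m → Bool), (∀ f, f ∈ A ↔ P (θ (f ∘ ι))) →
      (A.card : ℝ) / 2 ^ m = (#{o | P o} : ℝ) / Fintype.card Ω := by
    intro A hA
    have hA' : A = univ.filter fun f => P (θ (f ∘ ι)) := by
      ext f
      simp [hA]
    have h := PostBPPHash.card_filter_comp_equiv_mul ι hι θ P
    rw [hA', div_eq_div_iff (by positivity) hΩ.ne']
    exact_mod_cast h
  exact key _ fun f => by simpa only [mem_filter, mem_univ, true_and] using hE f

/-- **One-sided form**: if every sample outside a bad set `B ⊆ Ω` puts the coin string in `E`, and at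
most an `a/b` fraction of `Ω` is bad (`b · #{o | B o} ≤ a · |Ω|`), then `Pr_r[E] ≥ 1 - a/b`.
(The shape in which a counting theorem over a finite sample space — e.g.
`Literature.Algebra.EuclideanLattices.Khot.khot_gap_instances_of` — feeds `promiseRandReducible_of_uniformProb`.)
[folklore] -/
theorem le_uniformProb_of_marginal (ι : J → Fin m) (hι : Function.Injective ι) (θ : (J → Bool) ≃ Ω)
    (B : Ω → Prop) [DecidablePred B] (E : Set (List Bool))
    (hE : ∀ f : Fin m → Bool, ¬B (θ (f ∘ ι)) → List.ofFn f ∈ E) {a b : ℕ} (hb : 0 < b)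
    (hbad : b * #{o | B o} ≤ a * Fintype.card Ω) :
    1 - (a : ℝ) / b ≤ uniformProb m E := by
  classical
  have hΩ : (0 : ℝ) < Fintype.card Ω := by
    exact_mod_cast Fintype.card_pos_iff.2 ⟨θ fun _ => true⟩
  -- the sub-event of good samples
  let E' : Set (List Bool) := {r | ∃ f : Fin m → Bool, r = List.ofFn f ∧ ¬B (θ (f ∘ ι))}
  have hsub : E' ⊆ E := by
    rintro _ ⟨f, rfl, hf⟩
    exact hE f hf
  have hE' : ∀ f : Fin m → Bool, List.ofFn f ∈ E' ↔ ¬B (θ (f ∘ ι)) := by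
    intro f
    constructor
    · rintro ⟨g, hg, hgood⟩
      rwa [List.ofFn_injective hg]
    · exact fun h => ⟨f, rfl, h⟩
  have h1 : uniformProb m E' = (#{o | ¬B o} : ℝ) / Fintype.card Ω :=
    uniformProb_eq_of_marginal ι hι θ (fun o => ¬B o) E' hE'
  have h2 : (#{o | ¬B o} : ℝ) = Fintype.card Ω - #{o | B o} := by
    rw [filter_not, card_univ_sdiff]
    push_cast [Nat.cast_sub (card_le_univ _)]
    ring
  calc 1 - (a : ℝ) / b ≤ 1 - (#{o | B o} : ℝ) / Fintype.card Ω := by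
        have : (#{o | B o} : ℝ) / Fintype.card Ω ≤ a / b := by
          rw [div_le_div_iff₀ hΩ (by exact_mod_cast hb)]
          calc (#{o | B o} : ℝ) * b = b * #{o | B o} := by ring
            _ ≤ a * Fintype.card Ω := by exact_mod_cast hbad
        linarith
    _ = uniformProb m E' := by rw [h1, h2, sub_div, div_self hΩ.ne']
    _ ≤ uniformProb m E := by
        unfold uniformProb
        refine div_le_div_of_nonneg_right ?_ (by positivity)
        exact_mod_cast card_le_card fun r hr => by
          simp only [mem_filter, mem_univ, true_and] at hr ⊢
          exact hsub hr

end Marginal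

end Literature.Computability.MetaComplexity
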